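/-
Copyright (c) 2026 the pub-hodgecm-mathlib formalisation cell (harness21).  Prover seat hodgecm-mathlib-K2E3-p17 (g0), Track B «K2-LIT» ∕ h413, unit U5Kazhdan
of the line `K2_E3_EllipticInputs`: the WILD twin of E1 row B3(48)-RAM FILE 1 (the 17W∕15W∕16W∕18W engine, mechanical layer, bottom file).  2026-09-03.
-/
import Summits.HodgeConjecture.HodgeConjecture.Theorems.F0P3cStCharTSEPFunctionOrbitalOrbitsRamified  -- ★ 48-RAM FILE 1 p853505: the four PLACE-FREE `_of_involution` heads (used BY NAME) + the tame dischargers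
import Summits.HodgeConjecture.HodgeConjecture.Theorems.F0P3cDyRamWildPlaceDatum                    -- ★ (LH4-p02): `exists_isRamifiedQuadraticDatum_of_placesOver` (the datum at a CM place, ANY uniformiser)
import Summits.HodgeConjecture.HodgeConjecture.Theorems.F0P3cDyRamWildTransitivity                  -- ★ p854580 (LH4-p02): `htr₂_of_isRamifiedQuadraticDatum`; brings ★ htr₀-WILD p854568 `…_of_isSelfDualLattice_of_ramified`
import Literature.NumberTheory.Automorphic.UnitaryLatticeTreeRootStarOrbitWild                       -- ★ p854659 (LH4-p01): `flagTransitive_of_isRamifiedQuadraticDatum` (one edge orbit at the datum)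
import HarnessLib

/-!
# K2_E3 road (h413 = stmt-HodgeConjecture-24833), unit U5Kazhdan — THE WILD ENGINE, mechanical layer, FILE «48-W ∕ 1»: vertex ∕ edge orbits of `G_v = U(Φ₃)(L⁺_v)`
# on its lattice tree and the orbital integral of a `K`-type function on the edge orbit, AT EVERY RAMIFIED PLACE (tame re-proved, WILD = dyadic new)

Cell `pub/hodgecm-mathlib` (D-0151), Track B; seat K2E3-p17 (g0) (row #17 `sig_K2E3PseudoCoeffExistsElliptic`; K2E3-plan (g1) DEALS BATCH #1 + SYNC 22:07:32Z; K2E3-p21's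
tower census 22:06:26Z (c) «the mechanical layer can be dealt bottom-up … FILE (A)-WILD orbit data, EllipticFixedTreeWild, EPFunctionOrbital{Orbits,Elliptic}Wild,
CharacterEllipticUniformWild first»).  THEOREMS ONLY (no definition ∕ instance ∕ notation ∕ named fact ∕ `sorry`); ★-only imports (never a `Cruxes/…/Lines` module).

WHAT.  ★ 48-RAM FILE 1 `F0P3cStCharTSEPFunctionOrbitalOrbitsRamified` states four PLACE-FREE heads `_of_involution` (transitivity letters `htr₀`, `htr₂`, `hflag`, `htrE`
hypothesis-style) and discharges them at a TAME place (`_of_v_two`: `|2|_w = 1`; `_of_neg`: `σ_w ϖ = −ϖ`).  THIS FILE discharges the SAME four heads at EVERY RAMIFIED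
place `w ∣ v` (`he : e(w∣v) ≠ 1`), ANY uniformiser `ϖ` (`hϖ : |ϖ|_w = q⁻¹`), with NO hypothesis on `|2|_w` — so at the WILD (dyadic) places too — by reading the letters at
Track A U0's RAMIFIED QUADRATIC DATUM `IsRamifiedQuadraticDatum σ_w ϖ d t` (★ `exists_isRamifiedQuadraticDatum_of_placesOver`, no parity ∕ tameness condition):
`htr₀` := ★ htr₀-WILD `exists_unitary_mapGL_stdLattice_eq_of_isSelfDualLattice_of_ramified` (p854568), `htr₂` := ★ `htr₂_of_isRamifiedQuadraticDatum` (p854580),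
`hflag` := ★ `flagTransitive_of_isRamifiedQuadraticDatum` (p854659), `|σ_w ·| = |·|` := ★ `valued_galAdicCompletionMap` — exactly the re-lettering of ★ #21
`K2E3EPFunctionGWild` (p854998) ∕ ★ `K2E3EPFunctionGRamifiedExplicit` (p855067): tame block `(hσ hvσ hϖ hσϖ hres h2 hnorm)` ↦ `(he) (hϖ)` + `obtain ⟨d, t, hD⟩`.
Statements = the tame dischargers' VERBATIM with that single binder substitution; names `…_of_ramificationIdx_ne_one` (p855067's convention).
* §1 `exists_actionHom_apply_eq_of_isVertexLattice_zero_of_ramificationIdx_ne_one` · `exists_actionHom_apply_eq_of_isVertexLattice_two_of_ramificationIdx_ne_one` ·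
  `exists_mapEdgeSet_eq_of_ramificationIdx_ne_one` · `classOrbitalIntegral_kType_edge_eq_of_ramificationIdx_ne_one`.
Consumers (the next files of the layer): (A)-WILD `K2E3TreeOrbitDataGqsWild` (orbit data), 48-W FILE 2, B3(53)-W, and through them 61b-W ∕ 58-W-W ∕ 17W ∕ 73-W ∕ X0′-W.

HONEST LABEL: HC_CM is proved only modulo the 7 printed citations (2 remaining named inputs: hLiu418 = stmt-HodgeConjecture-24832, h413 =
stmt-HodgeConjecture-24833) until rung 0 closes; `--supports stmt-HodgeConjecture-24833` helper (a brick of row #17's wild residue); retires nothing by itself.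

## References
* [SchneiderStuhler1997] P. Schneider, U. Stuhler, *Representation theory and sheaves on the Bruhat–Tits building*, Publ. Math. IHÉS 85 (1997): §III.4.
* [Kottwitz1988] R. E. Kottwitz, *Tamagawa numbers*, Ann. of Math. 127 (1988): §2.
* [Rogawski1990] J. D. Rogawski, *Automorphic Representations of Unitary Groups in Three Variables* (1990): §4.9 p. 54, §12.5 pp. 182–187.
* [BruhatTits1972] F. Bruhat, J. Tits, *Groupes réductifs sur un corps local* I, Publ. Math. IHÉS 41 (1972): §10.
* [Jacobowitz1962] R. Jacobowitz, *Hermitian forms over local fields*, Amer. J. Math. 84 (1962): §4–§8.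
-/

set_option autoImplicit false
-- the mandated namespace has the single-problem summit's repeated segment (`HodgeConjecture.HodgeConjecture`)
set_option linter.dupNamespace false

noncomputable section

open NumberField IsDedekindDomain MeasureTheory Measure
open scoped Pointwise Valued WithZero Matrix MatrixGroups
open Literature.NumberTheory.Rogawski1990 Literature.NumberTheory.Rogawski1990.Ch12Sec5
open Literature.NumberTheory.Automorphic Literature.NumberTheory.Automorphic.UnitaryGroup Literature.NumberTheory.Automorphic.UnitaryLatticeTree
open Literature.NumberTheory.Automorphic.HermitianLattice Literature.NumberTheory.GaloisRepresentations
open Literature.Combinatorics.SimpleGraph Literature.Combinatorics.SimpleGraph.OrientedIncidence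
open Literature.NumberTheory.Automorphic.UnitaryThreeFourFrame

namespace Summit.HodgeConjecture.HodgeConjecture.Cruxes.H413.K2E3EPFunctionOrbitalOrbitsWild

open Summit.HodgeConjecture.HodgeConjecture.Cruxes.H413
open Summit.HodgeConjecture.HodgeConjecture.Cruxes.H413.F0P3cStCharTSCharacterEllipticUniform
open Summit.HodgeConjecture.HodgeConjecture.Cruxes.H413.F0P3cStCharTSEPFunctionOrbitalOrbits
open Summit.HodgeConjecture.HodgeConjecture.Cruxes.H413.F0P3cStCharTSEPFunctionOrbitalOrbitsRamified
open Summit.HodgeConjecture.HodgeConjecture.Cruxes.H413.F0P3cDyRamWildPlaceDatum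
open Summit.HodgeConjecture.HodgeConjecture.Cruxes.H413.F0P3cDyRamWildTransitivity

section Datum

variable (L : Type) [Field L] [NumberField L] [IsCMField L] (v : HeightOneSpectrum (𝓞 ↥(maximalRealSubfield L)))
  (w : PlacesOver L v) (hw : IsCMField.complexConj L • w.1 = w.1) {ϖ : (w.1.adicCompletion L)}

/-! ## §2 The TAME dischargers (`_of_ramificationIdx_ne_one`: `|2| = 1` and an involution; `_of_ramificationIdx_ne_one`: `σ ϖ = −ϖ`, `|2| = 1`) -/

/-- **ONE ORBIT OF SELF-DUAL VERTICES at every place with `|2| = 1`** (`htr₀` by ★ `exists_unitary_mapGL_stdLattice_eq_of_isSelfDualLattice_of_ramificationIdx_ne_one`; in particular at a TAME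
RAMIFIED place). [cite: Jacobowitz1962, §4–§8] [cite: BruhatTits1972, §10] -/
theorem exists_actionHom_apply_eq_of_isVertexLattice_zero_of_ramificationIdx_ne_one
    (he : v.asIdeal.ramificationIdx' w.1.asIdeal ≠ 1) (hϖ : Valued.v ϖ = WithZero.exp (-1 : ℤ))
    (eA : (Gqs L v) ≃ₜ* ↥(unitaryGroupOfForm (galAdicCompletionMap (L := L) (IsCMField.complexConj L) hw) ((StdForm.antidiagonal 3).over (w.1.adicCompletion L))))
    {a : (Gqs L v) →* ((latticeGraph (galAdicCompletionMap (L := L) (IsCMField.complexConj L) hw) ϖ ((StdForm.antidiagonal 3).over (w.1.adicCompletion L))) ≃g (latticeGraph (galAdicCompletionMap (L := L) (IsCMField.complexConj L) hw) ϖ ((StdForm.antidiagonal 3).over (w.1.adicCompletion L))))} (ha : ∀ g, a g = latticeGraphIso (galAdicCompletionMap (L := L) (IsCMField.complexConj L) hw) ϖ ((StdForm.antidiagonal 3).over (w.1.adicCompletion L)) (eA g))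
    (x y : {M : Submodule 𝒪[(w.1.adicCompletion L)] (Fin 3 → (w.1.adicCompletion L)) // IsVertex (galAdicCompletionMap (L := L) (IsCMField.complexConj L) hw) ϖ ((StdForm.antidiagonal 3).over (w.1.adicCompletion L)) M}) (hx : IsVertexLattice (galAdicCompletionMap (L := L) (IsCMField.complexConj L) hw) ϖ ((StdForm.antidiagonal 3).over (w.1.adicCompletion L)) 0 x.1) (hy : IsVertexLattice (galAdicCompletionMap (L := L) (IsCMField.complexConj L) hw) ϖ ((StdForm.antidiagonal 3).over (w.1.adicCompletion L)) 0 y.1) : ∃ g : (Gqs L v), a g x = y := by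
  letI : Fintype 𝓀[w.1.adicCompletion L] := Fintype.ofFinite _
  obtain ⟨nd, nt, hD⟩ := exists_isRamifiedQuadraticDatum_of_placesOver L w hw he ϖ hϖ
  obtain ⟨hσ, hvσ, -, heven, hd, h1d, h2t⟩ := hD
  exact exists_actionHom_apply_eq_of_isVertexLattice_zero_of_involution L v w hw eA ha
    (exists_unitary_mapGL_stdLattice_eq_of_isSelfDualLattice_of_ramified hσ hvσ hϖ heven hd h1d h2t) x y hx hy

/-- **ONE ORBIT OF TYPE-TWO VERTICES at a tame ramified place** (`htr₂` by ★ `forall_isVertexLattice_two_exists_mapGL_N₁_eq_of_ramificationIdx_ne_one`). [cite: Jacobowitz1962, §8] [cite: BruhatTits1972, §10] -/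
theorem exists_actionHom_apply_eq_of_isVertexLattice_two_of_ramificationIdx_ne_one
    (he : v.asIdeal.ramificationIdx' w.1.asIdeal ≠ 1) (hϖ : Valued.v ϖ = WithZero.exp (-1 : ℤ))
    (eA : (Gqs L v) ≃ₜ* ↥(unitaryGroupOfForm (galAdicCompletionMap (L := L) (IsCMField.complexConj L) hw) ((StdForm.antidiagonal 3).over (w.1.adicCompletion L))))
    {a : (Gqs L v) →* ((latticeGraph (galAdicCompletionMap (L := L) (IsCMField.complexConj L) hw) ϖ ((StdForm.antidiagonal 3).over (w.1.adicCompletion L))) ≃g (latticeGraph (galAdicCompletionMap (L := L) (IsCMField.complexConj L) hw) ϖ ((StdForm.antidiagonal 3).over (w.1.adicCompletion L))))} (ha : ∀ g, a g = latticeGraphIso (galAdicCompletionMap (L := L) (IsCMField.complexConj L) hw) ϖ ((StdForm.antidiagonal 3).over (w.1.adicCompletion L)) (eA g))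
    (x y : {M : Submodule 𝒪[(w.1.adicCompletion L)] (Fin 3 → (w.1.adicCompletion L)) // IsVertex (galAdicCompletionMap (L := L) (IsCMField.complexConj L) hw) ϖ ((StdForm.antidiagonal 3).over (w.1.adicCompletion L)) M}) (hx : IsVertexLattice (galAdicCompletionMap (L := L) (IsCMField.complexConj L) hw) ϖ ((StdForm.antidiagonal 3).over (w.1.adicCompletion L)) 2 x.1) (hy : IsVertexLattice (galAdicCompletionMap (L := L) (IsCMField.complexConj L) hw) ϖ ((StdForm.antidiagonal 3).over (w.1.adicCompletion L)) 2 y.1) : ∃ g : (Gqs L v), a g x = y := by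
  letI : Fintype 𝓀[w.1.adicCompletion L] := Fintype.ofFinite _
  obtain ⟨nd, nt, hD⟩ := exists_isRamifiedQuadraticDatum_of_placesOver L w hw he ϖ hϖ
  exact exists_actionHom_apply_eq_of_isVertexLattice_two_of_involution L v w hw eA ha (htr₂_of_isRamifiedQuadraticDatum hD) x y hx hy

/-- **ONE ORBIT OF EDGES at every place with `|2| = 1`** (`hflag` by ★ E4-RAM `forall_flag_exists_unitary_of_ramificationIdx_ne_one`; no condition on `σ ϖ`). [cite: BruhatTits1972, §10]
[cite: SchneiderStuhler1997, §III.4] -/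
theorem exists_mapEdgeSet_eq_of_ramificationIdx_ne_one
    (he : v.asIdeal.ramificationIdx' w.1.asIdeal ≠ 1) (hϖ : Valued.v ϖ = WithZero.exp (-1 : ℤ))
    (eA : (Gqs L v) ≃ₜ* ↥(unitaryGroupOfForm (galAdicCompletionMap (L := L) (IsCMField.complexConj L) hw) ((StdForm.antidiagonal 3).over (w.1.adicCompletion L))))
    {a : (Gqs L v) →* ((latticeGraph (galAdicCompletionMap (L := L) (IsCMField.complexConj L) hw) ϖ ((StdForm.antidiagonal 3).over (w.1.adicCompletion L))) ≃g (latticeGraph (galAdicCompletionMap (L := L) (IsCMField.complexConj L) hw) ϖ ((StdForm.antidiagonal 3).over (w.1.adicCompletion L))))} (ha : ∀ g, a g = latticeGraphIso (galAdicCompletionMap (L := L) (IsCMField.complexConj L) hw) ϖ ((StdForm.antidiagonal 3).over (w.1.adicCompletion L)) (eA g))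
    (τ : Orientation (latticeGraph (galAdicCompletionMap (L := L) (IsCMField.complexConj L) hw) ϖ ((StdForm.antidiagonal 3).over (w.1.adicCompletion L)))) (hτ : ∀ d, τ.tail d < τ.head d)
    (d d' : (latticeGraph (galAdicCompletionMap (L := L) (IsCMField.complexConj L) hw) ϖ ((StdForm.antidiagonal 3).over (w.1.adicCompletion L))).edgeSet) : ∃ g : (Gqs L v), (a g).mapEdgeSet d = d' := by
  letI : Fintype 𝓀[w.1.adicCompletion L] := Fintype.ofFinite _
  obtain ⟨nd, nt, hD⟩ := exists_isRamifiedQuadraticDatum_of_placesOver L w hw he ϖ hϖ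
  exact exists_mapEdgeSet_eq_of_involution L v w hw hD.2.1 hϖ
    (fun g₁ hg₁ => flagTransitive_of_isRamifiedQuadraticDatum _ ϖ nd nt hD g₁ hg₁) eA ha τ hτ d d'

set_option maxHeartbeats 400000 in
/-- **THE ORBITAL INTEGRAL OF A `K`-TYPE FUNCTION ON THE EDGE ORBIT at every place with `|2| = 1`** (in particular at a TAME RAMIFIED place): ★ 48's
`classOrbitalIntegral_kType_edge_eq` with `hd` replaced by `hσ hvσ hϖ h2`, conclusion VERBATIM (`htrE` by `exists_mapEdgeSet_eq_of_ramificationIdx_ne_one`). [cite: SchneiderStuhler1997, §III.4]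
[cite: Kottwitz1988, §2] [cite: Rogawski1990, §4.9 p. 54] -/
theorem classOrbitalIntegral_kType_edge_eq_of_ramificationIdx_ne_one
    (he : v.asIdeal.ramificationIdx' w.1.asIdeal ≠ 1) (hϖ : Valued.v ϖ = WithZero.exp (-1 : ℤ))
    (eA : (Gqs L v) ≃ₜ* ↥(unitaryGroupOfForm (galAdicCompletionMap (L := L) (IsCMField.complexConj L) hw) ((StdForm.antidiagonal 3).over (w.1.adicCompletion L))))
    {a : (Gqs L v) →* ((latticeGraph (galAdicCompletionMap (L := L) (IsCMField.complexConj L) hw) ϖ ((StdForm.antidiagonal 3).over (w.1.adicCompletion L))) ≃g (latticeGraph (galAdicCompletionMap (L := L) (IsCMField.complexConj L) hw) ϖ ((StdForm.antidiagonal 3).over (w.1.adicCompletion L))))} (ha : ∀ g, a g = latticeGraphIso (galAdicCompletionMap (L := L) (IsCMField.complexConj L) hw) ϖ ((StdForm.antidiagonal 3).over (w.1.adicCompletion L)) (eA g))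
    [MeasurableSpace (Gqs L v)] [BorelSpace (Gqs L v)]
    [∀ γ : (Gqs L v), MeasurableSpace ((Gqs L v) ⧸ Subgroup.centralizer ({γ} : Set (Gqs L v)))]
    [∀ γ : (Gqs L v), BorelSpace ((Gqs L v) ⧸ Subgroup.centralizer ({γ} : Set (Gqs L v)))]
    (νQv : Measure (Gqs L v)) [νQv.IsHaarMeasure] [νQv.IsMulRightInvariant]
    {mQv : OrbitalMeasureFamily (Gqs L v)} (hcanQ : mQv.IsCanonical (fun γ => IsRegularElt (γ.val : GL (Fin 3) (UnitaryGroup.LocalRing L v))) νQv)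
    (τ : Orientation (latticeGraph (galAdicCompletionMap (L := L) (IsCMField.complexConj L) hw) ϖ ((StdForm.antidiagonal 3).over (w.1.adicCompletion L)))) (hτ : ∀ d, τ.tail d < τ.head d)
    {e : ℕ} {U : {M : Submodule 𝒪[(w.1.adicCompletion L)] (Fin 3 → (w.1.adicCompletion L)) // IsVertex (galAdicCompletionMap (L := L) (IsCMField.complexConj L) hw) ϖ ((StdForm.antidiagonal 3).over (w.1.adicCompletion L)) M} → Subgroup (Gqs L v)}
    (hU : ∀ x g, g ∈ U x ↔ mapGL ((eA g : ↥(unitaryGroupOfForm (galAdicCompletionMap (L := L) (IsCMField.complexConj L) hw) ((StdForm.antidiagonal 3).over (w.1.adicCompletion L)))) : GL (Fin 3) (w.1.adicCompletion L)) x.1 = x.1 ∧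
      x.1.map ((Matrix.toLin' ((((eA g : ↥(unitaryGroupOfForm (galAdicCompletionMap (L := L) (IsCMField.complexConj L) hw) ((StdForm.antidiagonal 3).over (w.1.adicCompletion L)))) : GL (Fin 3) (w.1.adicCompletion L)) : Matrix (Fin 3) (Fin 3) (w.1.adicCompletion L)) - 1)).restrictScalars 𝒪[(w.1.adicCompletion L)]) ≤ scaleLattice (ϖ ^ (e + 1)) x.1)
    (hEo : ∀ d : (latticeGraph (galAdicCompletionMap (L := L) (IsCMField.complexConj L) hw) ϖ ((StdForm.antidiagonal 3).over (w.1.adicCompletion L))).edgeSet, IsOpen ((U (τ.head d) ⊔ U (τ.tail d) : Subgroup (Gqs L v)) : Set (Gqs L v)))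
    (hEc : ∀ d : (latticeGraph (galAdicCompletionMap (L := L) (IsCMField.complexConj L) hw) ϖ ((StdForm.antidiagonal 3).over (w.1.adicCompletion L))).edgeSet, IsCompact ((U (τ.head d) ⊔ U (τ.tail d) : Subgroup (Gqs L v)) : Set (Gqs L v)))
    (d₁ : (latticeGraph (galAdicCompletionMap (L := L) (IsCMField.complexConj L) hw) ϖ ((StdForm.antidiagonal 3).over (w.1.adicCompletion L))).edgeSet) (P₁ : Subgroup (Gqs L v)) (hP₁ : ∀ g, g ∈ P₁ ↔ (a g).mapEdgeSet d₁ = d₁)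
    {V : Type*} [AddCommGroup V] [Module ℂ V] (ρ : Representation ℂ (Gqs L v) V) [FiniteDimensional ℂ ↥(ρ.fixedPoints (U (τ.head d₁) ⊔ U (τ.tail d₁)))]
    (τ₁ : Representation ℂ ↥P₁ ↥(ρ.fixedPoints (U (τ.head d₁) ⊔ U (τ.tail d₁))))
    (hτρ₁ : ∀ (p : ↥P₁) (x : ↥(ρ.fixedPoints (U (τ.head d₁) ⊔ U (τ.tail d₁)))), ((τ₁ p x : ↥(ρ.fixedPoints (U (τ.head d₁) ⊔ U (τ.tail d₁)))) : V) = ρ (p : (Gqs L v)) (x : V))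
    (hτ₁ : ∀ p : ↥P₁, (p : (Gqs L v)) ∈ U (τ.head d₁) ⊔ U (τ.tail d₁) → τ₁ p = 1)
    {f : (Gqs L v) → ℂ} (hfP : ∀ (g : (Gqs L v)) (hg : g ∈ P₁), f g = Representation.character τ₁ ⟨g, hg⟩⁻¹) (hf0 : ∀ g ∉ P₁, f g = 0)
    {γ : (Gqs L v)} (hreg : IsRegularElt (γ.val : GL (Fin 3) (UnitaryGroup.LocalRing L v)))
    (hell : IsCompact ((Subgroup.centralizer ({γ} : Set (Gqs L v))) : Set (Gqs L v))) :
    classOrbitalIntegral mQv f (ConjClasses.mk γ) =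
      νQv.real (P₁ : Set (Gqs L v)) • ∑ᶠ d ∈ {d : (latticeGraph (galAdicCompletionMap (L := L) (IsCMField.complexConj L) hw) ϖ ((StdForm.antidiagonal 3).over (w.1.adicCompletion L))).edgeSet | (a γ).mapEdgeSet d = d}, ρ.levelTrace (hEo d) (hEc d) γ⁻¹ :=
  classOrbitalIntegral_kType_edge_eq_of_involution L v w hw (fun x => valued_galAdicCompletionMap (L := L) (IsCMField.complexConj L) hw x) hϖ eA ha νQv hcanQ τ hτ
    (exists_mapEdgeSet_eq_of_ramificationIdx_ne_one L v w hw he hϖ eA ha τ hτ) hU hEo hEc d₁ P₁ hP₁ ρ τ₁ hτρ₁ hτ₁ hfP hf0 hreg hell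

end Datum

end Summit.HodgeConjecture.HodgeConjecture.Cruxes.H413.K2E3EPFunctionOrbitalOrbitsWild

end
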